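import Summits.AtomisticToContinuum.BoseEinsteinCondensation.Theses.BECThomsonPrinciple
import Summits.AtomisticToContinuum.BoseEinsteinCondensation.Theorems.StaticResponseBound.Negative.Basic
import Summits.AtomisticToContinuum.BoseEinsteinCondensation.Theorems.DensityResponse.Negative.PeriodisedWell
import Summits.AtomisticToContinuum.BoseEinsteinCondensation.Theorems.DensityResponse.Negative.ModulatedProductState
import Literature.MathematicalPhysics.QuantumManyBody.WeightedCorrector
import Literature.MathematicalPhysics.QuantumManyBody.PeriodicBoseGasFourier
import Literature.MathematicalPhysics.QuantumManyBody.PeriodicBoseGasScatteringODE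
import Literature.MathematicalPhysics.QuantumManyBody.DiluteBoseGasUpperBoundLocalization

/-!
# Negative lemmas for crux `DensityResponse` (stmt-AtomisticToContinuum-9481) — stub checks for
# line `force-balance-constitutive`

Supports (does not close) stmt-AtomisticToContinuum-9481.  Refuter (drefute) by-products for the
picked line `Cruxes/DensityResponse/Lines/force-balance-constitutive.lean` (stubs S1–S4 =
`stub_transportStationary`, `stub_constitutiveCore`, `stub_kineticSignCoherence{Bounded,Unbounded}`,
`stub_truncationLimit`).  The line's vocabulary (`kvec`, `ksq`, `ksupSq`, `phase`, `kDeriv`,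
`sourceMean`, `effNumber`, `kineticStressWave`, `virialWave`, `stressWave`) and the stub statements
`CoreIneq`, `KinIneq`, `ConstitutiveCore`, `KineticSignCoherenceBounded`,
`KineticSignCoherenceUnbounded` are restated VERBATIM (a `Cruxes/…/Lines/*.lean` work file is not an
importable module), so every theorem below transfers to the skeleton by `Iff.rfl`.  Sorry-free.

Findings (kernel-checked):

* §2 `kinIneq_of_pos` — **S3a and S3b are trivial whenever `a > 0`**: for ANY potential `w`, any
  `ρ₀`, `N₀`, the inequality `KinIneq w a M ρ₀ (3M²/(2a)) N₀` follows from the stationarity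
  hypothesis ALONE (`K + I = s·N_eff − (|k|²/4)·m`, `N_eff ≥ 0`, `m ≤ 2N`) together with the window
  `|k|² ≤ 3k∞² ≤ 3M²ρ` and `ρa ≤ s`; the finite-energy, sub-ground, boundedness and truncation
  binders are not used.  Hence `kineticSignCoherenceBounded_of_zero_case` /
  `kineticSignCoherenceUnbounded_of_zero_case`: the stubs S3a/S3b REDUCE to potentials with
  `(scatteringLength v).toReal = 0` (i.e. `v = 0` a.e., the free gas), where the docstring's
  `K ≥ −2T ≥ −4sN` argument applies.  (Information for the lead: the "integrated virial domination"
  of the proof plan is unnecessary inside the window.)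
* §3 `coreIneq_iff_noSign`, `constitutiveCore_iff_noSign` — in S2 the binder `0 ≤ m(Φ)` is NOT
  load-bearing: for a transport-stationary state with `m < 0` the conclusion holds outright
  (`κρa·m ≤ 0 ≤ s·N_eff + (|k|²/4)|m| + C₁sN = K + I + C₁sN`).
* §3 `coreIneq_iff_lr` — on transport-stationary states the constitutive inequality IS the
  linear-response bound `(κρa + |k|²/4)·m ≤ s·N_eff + C₁·s·N` (pure rearrangement of the
  stationarity identity): S2 is the crux's `s → 0` content verbatim, with `E₀(v_t)` entering only
  through the class constraint.
* §4 `not_transportStationaryAnyMode` — **`n ≠ 0` is load-bearing in S1**: with the binder `n ≠ 0`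
  deleted, `TransportStationary` is FALSE.  Witness `N = 2`, `L = 1`, `w =` the square well of
  height `1` and radius `2` (so `ω₃ ≤ w^per ≤ 27ω₃` on the whole cell, `ω₃ = |B₁| > 0`), `n = 0`,
  `s = 0`, `Φ =` the modulated product state: at `n = 0` the kinetic stress wave and `|k|²` vanish
  (Lean junk `x/0 = 0` included), `N_eff = 0`, and the virial wave degenerates to
  `2∫ W|Φ'|² ≥ 2ω₃ > 0`, so no state is "transport-stationary".  (The skeleton has the binder; this
  certifies the docstring's claim and Disproof (a) at the level of the stub.)
-/

namespace Summit.AtomisticToContinuum.BoseEinsteinCondensation.Theorems.DensityResponse.Negative.ForceBalanceStubs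

open MeasureTheory
open scoped ENNReal
open Literature.MathematicalPhysics.QuantumManyBody.BoseGas
open Summit.AtomisticToContinuum.BoseEinsteinCondensation.Theses
open Summit.AtomisticToContinuum.BoseEinsteinCondensation.Theorems.StaticResponseBound.Negative
  (integral_norm_sq_eq_one)

noncomputable section

/-! ## §1 The line's vocabulary and stub statements (verbatim copies) -/

section Vocabulary

variable {N : ℕ} {L : ℝ}

/-- The wave vector `k = (2π/L)·n ∈ ℝ³`. Verbatim copy of the skeleton's `kvec`. [card force-balance-constitutive] -/
def kvec (L : ℝ) (n : Fin 3 → ℤ) : Space := WithLp.toLp 2 fun j => 2 * Real.pi / L * (n j : ℝ)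

/-- `q = |k|² = (2π/L)² ∑ⱼ nⱼ²`. Verbatim copy of the skeleton's `ksq`. [card force-balance-constitutive] -/
def ksq (L : ℝ) (n : Fin 3 → ℤ) : ℝ := (2 * Real.pi / L) ^ 2 * ∑ j, (n j : ℝ) ^ 2

/-- `k∞² = (2π‖n‖∞/L)²`. Verbatim copy of the skeleton's `ksupSq`. [card force-balance-constitutive] -/
def ksupSq (L : ℝ) (n : Fin 3 → ℤ) : ℝ := (2 * Real.pi * ‖(fun j => (n j : ℝ))‖ / L) ^ 2

/-- The phase `θᵢ(X) = k·xᵢ`. Verbatim copy of the skeleton's `phase`. [card force-balance-constitutive] -/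
def phase (L : ℝ) (n : Fin 3 → ℤ) (X : Config N) (i : Fin N) : ℝ :=
  2 * Real.pi / L * ∑ j, (n j : ℝ) * X i j

/-- `k·∇ᵢ g (X)`. Verbatim copy of the skeleton's `kDeriv`. [card force-balance-constitutive] -/
def kDeriv (L : ℝ) (n : Fin 3 → ℤ) (g : Config N → ℂ) (X : Config N) (i : Fin N) : ℂ :=
  fderiv ℝ g X (Pi.single i (kvec L n))

/-- The density wave `m(Φ)`. Verbatim copy of the skeleton's `sourceMean`. [card force-balance-constitutive] -/
def sourceMean (n : Fin 3 → ℤ) (Φ : PeriodicTrialState N L) : ℝ :=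
  ∫ X in cellN N L, (∑ i, 2 * Real.cos (2 * Real.pi / L * ∑ j, (n j : ℝ) * X i j)) * ‖Φ.ψ X‖ ^ 2

/-- `N_eff(Φ)`. Verbatim copy of the skeleton's `effNumber`. [card force-balance-constitutive] -/
def effNumber (n : Fin 3 → ℤ) (Φ : PeriodicTrialState N L) : ℝ :=
  ∫ X in cellN N L, (∑ i, 2 * Real.sin (phase L n X i) ^ 2) * ‖Φ.ψ X‖ ^ 2

/-- Kinetic stress wave `K_k(Φ)`. Verbatim copy of the skeleton's `kineticStressWave`. [card force-balance-constitutive] -/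
def kineticStressWave (n : Fin 3 → ℤ) (Φ : PeriodicTrialState N L) : ℝ :=
  ∫ X in cellN N L, ∑ i, 2 * Real.cos (phase L n X i) * (‖kDeriv L n Φ.ψ X i‖ ^ 2 / ksq L n)

/-- Virial wave `I_k(Φ)`. Verbatim copy of the skeleton's `virialWave`. [card force-balance-constitutive] -/
def virialWave (w : ℝ → ℝ≥0∞) (n : Fin 3 → ℤ) (Φ : PeriodicTrialState N L) : ℝ :=
  ∫ X in cellN N L, (periodicInteraction w L X).toReal *
    ∑ i, (Real.cos (phase L n X i) * ‖Φ.ψ X‖ ^ 2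
      + Real.sin (phase L n X i) / ksq L n * (2 * ((starRingEnd ℂ) (Φ.ψ X) * kDeriv L n Φ.ψ X i).re))

/-- Stress wave `P_k(Φ) = K_k + (|k|²/4)m + I_k`. Verbatim copy of the skeleton's `stressWave`. [card force-balance-constitutive] -/
def stressWave (w : ℝ → ℝ≥0∞) (n : Fin 3 → ℤ) (Φ : PeriodicTrialState N L) : ℝ :=
  kineticStressWave n Φ + ksq L n / 4 * sourceMean n Φ + virialWave w n Φ

end Vocabulary

/-- The constitutive inequality. Verbatim copy of the skeleton's `CoreIneq` (statement of S2's body). [card force-balance-constitutive] -/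
def CoreIneq (w : ℝ → ℝ≥0∞) (a M ρ₀ κ C₁ : ℝ) (N₀ : ℕ) : Prop :=
  ∀ N : ℕ, N₀ ≤ N → ∀ L : ℝ, 0 < L → (N : ℝ) ≤ ρ₀ * L ^ 3 → ∀ n : Fin 3 → ℤ, n ≠ 0 →
    2 * Real.pi * ‖(fun j => (n j : ℝ))‖ / L ≤ M * Real.sqrt (N / L ^ 3) →
    ∀ s : ℝ, 0 ≤ s → s ≤ N / L ^ 3 * a →
    ∀ Φ : PeriodicTrialState N L, periodicEnergy w Φ ≠ ⊤ →
      stressWave w n Φ = s * effNumber n Φ →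
      (periodicEnergy w Φ).toReal - s * sourceMean n Φ ≤ (periodicGroundStateEnergy w N L).toReal →
      0 ≤ sourceMean n Φ →
        κ * (N / L ^ 3 * a) * sourceMean n Φ ≤ kineticStressWave n Φ + virialWave w n Φ + C₁ * s * N

/-- Kinetic sign-coherence. Verbatim copy of the skeleton's `KinIneq` (statement of S3a/S3b's body). [card force-balance-constitutive] -/
def KinIneq (w : ℝ → ℝ≥0∞) (a M ρ₀ C' : ℝ) (N₀ : ℕ) : Prop :=
  ∀ N : ℕ, N₀ ≤ N → ∀ L : ℝ, 0 < L → (N : ℝ) ≤ ρ₀ * L ^ 3 → ∀ n : Fin 3 → ℤ, n ≠ 0 →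
    2 * Real.pi * ‖(fun j => (n j : ℝ))‖ / L ≤ M * Real.sqrt (N / L ^ 3) →
    ∀ s : ℝ, 0 ≤ s → N / L ^ 3 * a ≤ s →
    ∀ Φ : PeriodicTrialState N L, periodicEnergy w Φ ≠ ⊤ →
      stressWave w n Φ = s * effNumber n Φ →
      (periodicEnergy w Φ).toReal - s * sourceMean n Φ ≤ (periodicGroundStateEnergy w N L).toReal →
        -(C' * s * N) ≤ kineticStressWave n Φ + virialWave w n Φ

/-- S2. Verbatim copy of the skeleton's `ConstitutiveCore`. [card force-balance-constitutive] -/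
def ConstitutiveCore : Prop :=
  ∀ v : ℝ → ℝ≥0∞, IsRepulsiveFiniteRange v → ∀ M : ℝ, 0 < M →
    ∃ ρ₀ κ C₁ : ℝ, 0 < ρ₀ ∧ 0 < κ ∧ 0 < C₁ ∧ ∃ N₀ t₀ : ℕ, ∀ t : ℕ, t₀ ≤ t →
      CoreIneq (truncPotential v t) (scatteringLength v).toReal M ρ₀ κ C₁ N₀

/-- S3a. Verbatim copy of the skeleton's `KineticSignCoherenceBounded`. [card force-balance-constitutive] -/
def KineticSignCoherenceBounded : Prop :=
  ∀ v : ℝ → ℝ≥0∞, IsRepulsiveFiniteRange v → (∃ B : ℝ, ∀ r, v r ≤ ENNReal.ofReal B) → ∀ M : ℝ, 0 < M →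
    ∃ ρ₀ C' : ℝ, 0 < ρ₀ ∧ 0 < C' ∧ ∃ N₀ : ℕ, KinIneq v (scatteringLength v).toReal M ρ₀ C' N₀

/-- S3b. Verbatim copy of the skeleton's `KineticSignCoherenceUnbounded`. [card force-balance-constitutive] -/
def KineticSignCoherenceUnbounded : Prop :=
  ∀ v : ℝ → ℝ≥0∞, IsRepulsiveFiniteRange v → (∀ B : ℝ, ∃ r, ENNReal.ofReal B < v r) → ∀ M : ℝ, 0 < M →
    ∃ ρ₀ C' : ℝ, 0 < ρ₀ ∧ 0 < C' ∧ ∃ N₀ t₀ : ℕ, ∀ t : ℕ, t₀ ≤ t →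
      KinIneq (truncPotential v t) (scatteringLength v).toReal M ρ₀ C' N₀

/-! ### Elementary bounds -/

section Lemmas

variable {N : ℕ} {L : ℝ}

/-- A bounded continuous weight integrated against `|Ψ|² dX` on the cell is bounded by its bound
(copy of the skeleton's lemma). [folklore] -/
theorem abs_integral_mul_norm_sq_le (Ψ : PeriodicTrialState N L) {g : Config N → ℝ} (hg : Continuous g)
    {G : ℝ} (hG : ∀ X, |g X| ≤ G) : |∫ X in cellN N L, g X * ‖Ψ.ψ X‖ ^ 2| ≤ G := by
  have hψc : Continuous fun X => ‖Ψ.ψ X‖ ^ 2 := (Ψ.contDiff.continuous.norm).pow 2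
  have hi : IntegrableOn (fun X => g X * ‖Ψ.ψ X‖ ^ 2) (cellN N L) volume :=
    integrableOn_cellN (hg.mul hψc) L
  have hi2 : IntegrableOn (fun X => G * ‖Ψ.ψ X‖ ^ 2) (cellN N L) volume :=
    integrableOn_cellN (continuous_const.mul hψc) L
  calc |∫ X in cellN N L, g X * ‖Ψ.ψ X‖ ^ 2|
      ≤ ∫ X in cellN N L, |g X * ‖Ψ.ψ X‖ ^ 2| := abs_integral_le_integral_abs
    _ ≤ ∫ X in cellN N L, G * ‖Ψ.ψ X‖ ^ 2 := by
        refine integral_mono hi.abs hi2 fun X => ?_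
        show |g X * ‖Ψ.ψ X‖ ^ 2| ≤ G * ‖Ψ.ψ X‖ ^ 2
        rw [abs_mul, abs_of_nonneg (sq_nonneg ‖Ψ.ψ X‖)]
        exact mul_le_mul_of_nonneg_right (hG X) (sq_nonneg _)
    _ = G := by rw [integral_const_mul, integral_norm_sq_eq_one, mul_one]

/-- The phase of particle `i` is continuous in the configuration (copy). [folklore] -/
theorem continuous_phase (L : ℝ) (n : Fin 3 → ℤ) (i : Fin N) :
    Continuous fun X : Config N => phase L n X i := by
  unfold phase
  refine continuous_const.mul (continuous_finsetSum _ fun j _ => continuous_const.mul ?_)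
  fun_prop

/-- `|m(Φ)| ≤ 2N` (copy of the skeleton's `abs_sourceMean_le`). [folklore] -/
theorem abs_sourceMean_le (n : Fin 3 → ℤ) (Φ : PeriodicTrialState N L) : |sourceMean n Φ| ≤ 2 * N := by
  unfold sourceMean
  refine abs_integral_mul_norm_sq_le Φ ?_ fun X => ?_
  · refine continuous_finsetSum _ fun i _ => continuous_const.mul (Real.continuous_cos.comp ?_)
    exact continuous_phase L n i
  · calc |∑ i : Fin N, 2 * Real.cos (2 * Real.pi / L * ∑ j, (n j : ℝ) * X i j)|
        ≤ ∑ i : Fin N, |2 * Real.cos (2 * Real.pi / L * ∑ j, (n j : ℝ) * X i j)| :=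
          Finset.abs_sum_le_sum_abs _ _
      _ ≤ ∑ _i : Fin N, (2 : ℝ) := Finset.sum_le_sum fun i _ => by
          rw [abs_mul, abs_of_pos (by norm_num : (0 : ℝ) < 2)]
          nlinarith [Real.abs_cos_le_one (2 * Real.pi / L * ∑ j, (n j : ℝ) * X i j)]
      _ = 2 * N := by
          rw [Finset.sum_const, Finset.card_univ, Fintype.card_fin, nsmul_eq_mul, mul_comm]

/-- `N_eff(Φ) ≥ 0` (the integrand `2∑ᵢ sin²θᵢ |Φ|²` is non-negative). [folklore] -/
theorem effNumber_nonneg (n : Fin 3 → ℤ) (Φ : PeriodicTrialState N L) : 0 ≤ effNumber n Φ :=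
  integral_nonneg fun X => mul_nonneg (Finset.sum_nonneg fun i _ => by positivity) (sq_nonneg _)

/-- `|k|² ≥ 0`. [folklore] -/
theorem ksq_nonneg (L : ℝ) (n : Fin 3 → ℤ) : 0 ≤ ksq L n :=
  mul_nonneg (sq_nonneg _) (Finset.sum_nonneg fun _ _ => sq_nonneg _)

/-- `|k|² ≤ 3 k∞²` (Euclidean versus sup norm of the mode: `∑ⱼ nⱼ² ≤ 3‖n‖∞²`). [folklore] -/
theorem ksq_le_three_mul_ksupSq (L : ℝ) (n : Fin 3 → ℤ) : ksq L n ≤ 3 * ksupSq L n := by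
  unfold ksq ksupSq
  have h : ∀ j, (n j : ℝ) ^ 2 ≤ ‖(fun j => (n j : ℝ))‖ ^ 2 := fun j => by
    have h1 : ‖(n j : ℝ)‖ ≤ ‖(fun j => (n j : ℝ))‖ := norm_le_pi_norm (fun j => (n j : ℝ)) j
    rw [Real.norm_eq_abs] at h1
    calc (n j : ℝ) ^ 2 = |(n j : ℝ)| ^ 2 := (sq_abs _).symm
      _ ≤ ‖(fun j => (n j : ℝ))‖ ^ 2 := pow_le_pow_left₀ (abs_nonneg _) h1 2
  have hsum : ∑ j, (n j : ℝ) ^ 2 ≤ 3 * ‖(fun j => (n j : ℝ))‖ ^ 2 := by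
    calc ∑ j, (n j : ℝ) ^ 2 ≤ ∑ _j : Fin 3, ‖(fun j => (n j : ℝ))‖ ^ 2 :=
          Finset.sum_le_sum fun j _ => h j
      _ = 3 * ‖(fun j => (n j : ℝ))‖ ^ 2 := by
          rw [Finset.sum_const, Finset.card_univ, Fintype.card_fin, nsmul_eq_mul]
          push_cast
          ring
  calc (2 * Real.pi / L) ^ 2 * ∑ j, (n j : ℝ) ^ 2
      ≤ (2 * Real.pi / L) ^ 2 * (3 * ‖(fun j => (n j : ℝ))‖ ^ 2) :=
        mul_le_mul_of_nonneg_left hsum (sq_nonneg _)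
    _ = 3 * (2 * Real.pi * ‖(fun j => (n j : ℝ))‖ / L) ^ 2 := by ring

/-- The window `k∞ ≤ M√ρ` squared: `k∞² ≤ M²ρ`. [folklore] -/
theorem ksupSq_le_of_window {M : ℝ} (n : Fin 3 → ℤ) (hL : 0 < L)
    (hwin : 2 * Real.pi * ‖(fun j => (n j : ℝ))‖ / L ≤ M * Real.sqrt (N / L ^ 3)) :
    ksupSq L n ≤ M ^ 2 * (N / L ^ 3) := by
  unfold ksupSq
  have h0 : 0 ≤ 2 * Real.pi * ‖(fun j => (n j : ℝ))‖ / L := by positivity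
  have hρ : (0 : ℝ) ≤ N / L ^ 3 := by positivity
  calc (2 * Real.pi * ‖(fun j => (n j : ℝ))‖ / L) ^ 2 ≤ (M * Real.sqrt (N / L ^ 3)) ^ 2 :=
        pow_le_pow_left₀ h0 hwin 2
    _ = M ^ 2 * (N / L ^ 3) := by rw [mul_pow, Real.sq_sqrt hρ]

/-- Inside the window, `|k|² ≤ 3M²ρ`. [folklore] -/
theorem ksq_le_of_window {M : ℝ} (n : Fin 3 → ℤ) (hL : 0 < L)
    (hwin : 2 * Real.pi * ‖(fun j => (n j : ℝ))‖ / L ≤ M * Real.sqrt (N / L ^ 3)) :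
    ksq L n ≤ 3 * (M ^ 2 * (N / L ^ 3)) :=
  (ksq_le_three_mul_ksupSq L n).trans
    (mul_le_mul_of_nonneg_left (ksupSq_le_of_window n hL hwin) (by norm_num))

/-- The stationarity identity solved for the stress–virial wave: `K + I = s·N_eff − (|k|²/4)·m`. [folklore] -/
theorem kin_add_virial_eq_of_stationary {w : ℝ → ℝ≥0∞} {n : Fin 3 → ℤ} {s : ℝ}
    {Φ : PeriodicTrialState N L} (hstat : stressWave w n Φ = s * effNumber n Φ) :
    kineticStressWave n Φ + virialWave w n Φ = s * effNumber n Φ - ksq L n / 4 * sourceMean n Φ := by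
  unfold stressWave at hstat
  linarith

end Lemmas

/-! ## §2 S3a / S3b: kinetic sign-coherence is trivial for `a > 0` -/

/-- **Kinetic sign-coherence from stationarity alone (`a > 0`).** For every potential `w`, every
`ρ₀`, `N₀` and every `a > 0`: `KinIneq w a M ρ₀ (3M²/(2a)) N₀`.  Proof: by stationarity
`K + I = s N_eff − (|k|²/4) m ≥ −(|k|²/4)·2N`; the window gives `|k|² ≤ 3k∞² ≤ 3M²ρ`, and `ρ ≤ s/a`.
Neither the finite-energy nor the sub-ground binder is used, nor any property of `w`. [folklore] -/
theorem kinIneq_of_pos (w : ℝ → ℝ≥0∞) {a : ℝ} (ha : 0 < a) (M ρ₀ : ℝ) (N₀ : ℕ) :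
    KinIneq w a M ρ₀ (3 * M ^ 2 / (2 * a)) N₀ := by
  intro N _hN L hL _hNL n _hn hwin s hs has Φ _hE hstat _hsub
  have hq3 : ksq L n ≤ 3 * (M ^ 2 * (N / L ^ 3)) := ksq_le_of_window n hL hwin
  have hq0 : 0 ≤ ksq L n := ksq_nonneg L n
  have hm : sourceMean n Φ ≤ 2 * N := (le_abs_self _).trans (abs_sourceMean_le n Φ)
  have hNf : 0 ≤ effNumber n Φ := effNumber_nonneg n Φ
  have hNnn : (0 : ℝ) ≤ N := Nat.cast_nonneg N
  have hρ : (N : ℝ) / L ^ 3 ≤ s / a := (le_div_iff₀ ha).mpr has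
  have hq4 : 0 ≤ ksq L n / 4 := div_nonneg hq0 (by norm_num)
  have hA : ksq L n / 4 * sourceMean n Φ ≤ ksq L n / 4 * (2 * N) :=
    mul_le_mul_of_nonneg_left hm hq4
  have hB : ksq L n / 4 * (2 * N) ≤ 3 * (M ^ 2 * (N / L ^ 3)) / 4 * (2 * N) :=
    mul_le_mul_of_nonneg_right (by linarith) (by positivity)
  have hρ' : M ^ 2 * (N / L ^ 3) ≤ M ^ 2 * (s / a) := mul_le_mul_of_nonneg_left hρ (sq_nonneg M)
  have hC : 3 * (M ^ 2 * (N / L ^ 3)) / 4 * (2 * N) ≤ 3 * (M ^ 2 * (s / a)) / 4 * (2 * N) :=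
    mul_le_mul_of_nonneg_right (by linarith) (by positivity)
  have hD : 3 * (M ^ 2 * (s / a)) / 4 * (2 * N) = 3 * M ^ 2 / (2 * a) * s * N := by
    field_simp
    ring
  have hsNf : 0 ≤ s * effNumber n Φ := mul_nonneg hs hNf
  rw [kin_add_virial_eq_of_stationary hstat]
  linarith

/-- The lead's registered sub-stub `stub_kinIneqOfPos` (item stmt-AtomisticToContinuum-9481, skeleton
5b7e7914fe83), verbatim signature; the hypothesis `0 < M` is not needed. [folklore] -/
theorem stub_kinIneqOfPos_holds :
    ∀ (w : ℝ → ℝ≥0∞) (a M ρ₀ : ℝ) (N₀ : ℕ), 0 < a → 0 < M → KinIneq w a M ρ₀ (3 * M ^ 2 / (2 * a)) N₀ :=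
  fun w _a M ρ₀ N₀ ha _hM => kinIneq_of_pos w ha M ρ₀ N₀

/-- S3a's conclusion for every `v` of positive scattering length (`ρ₀ = 1`, `C' = 3M²/(2a)`, `N₀ = 0`);
boundedness, admissibility and finite range are not used. [folklore] -/
theorem kineticSignCoherenceBounded_of_pos (v : ℝ → ℝ≥0∞) (ha : 0 < (scatteringLength v).toReal)
    (M : ℝ) (hM : 0 < M) :
    ∃ ρ₀ C' : ℝ, 0 < ρ₀ ∧ 0 < C' ∧ ∃ N₀ : ℕ, KinIneq v (scatteringLength v).toReal M ρ₀ C' N₀ :=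
  ⟨1, 3 * M ^ 2 / (2 * (scatteringLength v).toReal), one_pos, by positivity, 0,
    kinIneq_of_pos v ha M 1 0⟩

/-- S3b's conclusion for every `v` of positive scattering length, uniformly in the truncation height
(`t₀ = 0`: nothing about the truncation is used). [folklore] -/
theorem kineticSignCoherenceUnbounded_of_pos (v : ℝ → ℝ≥0∞) (ha : 0 < (scatteringLength v).toReal)
    (M : ℝ) (hM : 0 < M) :
    ∃ ρ₀ C' : ℝ, 0 < ρ₀ ∧ 0 < C' ∧ ∃ N₀ t₀ : ℕ, ∀ t : ℕ, t₀ ≤ t →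
      KinIneq (truncPotential v t) (scatteringLength v).toReal M ρ₀ C' N₀ :=
  ⟨1, 3 * M ^ 2 / (2 * (scatteringLength v).toReal), one_pos, by positivity, 0, 0,
    fun t _ => kinIneq_of_pos (truncPotential v t) ha M 1 0⟩

/-- **S3a reduces to its zero-scattering-length case** (`a(v) = 0`, i.e. `v = 0` a.e. by the tree's
`LSSY2005_zeroScatteringLength_holds`): if `KinIneq v 0 M ρ₀ C' N₀` is available for such `v`, the
stub `KineticSignCoherenceBounded` holds. [folklore] -/
theorem kineticSignCoherenceBounded_of_zero_case
    (h0 : ∀ v : ℝ → ℝ≥0∞, IsRepulsiveFiniteRange v → (∃ B : ℝ, ∀ r, v r ≤ ENNReal.ofReal B) →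
      (scatteringLength v).toReal = 0 → ∀ M : ℝ, 0 < M →
      ∃ ρ₀ C' : ℝ, 0 < ρ₀ ∧ 0 < C' ∧ ∃ N₀ : ℕ, KinIneq v 0 M ρ₀ C' N₀) :
    KineticSignCoherenceBounded := by
  intro v hv hb M hM
  rcases (ENNReal.toReal_nonneg : 0 ≤ (scatteringLength v).toReal).eq_or_lt with h | h
  · rw [← h]
    exact h0 v hv hb h.symm M hM
  · exact kineticSignCoherenceBounded_of_pos v h M hM

/-- **S3b reduces to its zero-scattering-length case** likewise. [folklore] -/
theorem kineticSignCoherenceUnbounded_of_zero_case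
    (h0 : ∀ v : ℝ → ℝ≥0∞, IsRepulsiveFiniteRange v → (∀ B : ℝ, ∃ r, ENNReal.ofReal B < v r) →
      (scatteringLength v).toReal = 0 → ∀ M : ℝ, 0 < M →
      ∃ ρ₀ C' : ℝ, 0 < ρ₀ ∧ 0 < C' ∧ ∃ N₀ t₀ : ℕ, ∀ t : ℕ, t₀ ≤ t →
        KinIneq (truncPotential v t) 0 M ρ₀ C' N₀) :
    KineticSignCoherenceUnbounded := by
  intro v hv hub M hM
  rcases (ENNReal.toReal_nonneg : 0 ≤ (scatteringLength v).toReal).eq_or_lt with h | h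
  · rw [← h]
    exact h0 v hv hub h.symm M hM
  · exact kineticSignCoherenceUnbounded_of_pos v h M hM

/-! ## §3 S2: the sign binder is decoration; the linear-response form -/

/-- `CoreIneq` with the binder `0 ≤ m(Φ)` deleted (everything else verbatim). -/
def CoreIneqNoSign (w : ℝ → ℝ≥0∞) (a M ρ₀ κ C₁ : ℝ) (N₀ : ℕ) : Prop :=
  ∀ N : ℕ, N₀ ≤ N → ∀ L : ℝ, 0 < L → (N : ℝ) ≤ ρ₀ * L ^ 3 → ∀ n : Fin 3 → ℤ, n ≠ 0 →
    2 * Real.pi * ‖(fun j => (n j : ℝ))‖ / L ≤ M * Real.sqrt (N / L ^ 3) →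
    ∀ s : ℝ, 0 ≤ s → s ≤ N / L ^ 3 * a →
    ∀ Φ : PeriodicTrialState N L, periodicEnergy w Φ ≠ ⊤ →
      stressWave w n Φ = s * effNumber n Φ →
      (periodicEnergy w Φ).toReal - s * sourceMean n Φ ≤ (periodicGroundStateEnergy w N L).toReal →
        κ * (N / L ^ 3 * a) * sourceMean n Φ ≤ kineticStressWave n Φ + virialWave w n Φ + C₁ * s * N

/-- **The binder `0 ≤ m(Φ)` of S2 is not load-bearing** (for `a, κ, C₁ ≥ 0`, which the stub's
`∃ κ C₁ > 0` and `a = (scatteringLength v).toReal ≥ 0` guarantee): on a transport-stationary state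
with `m < 0` one has `K + I = s N_eff + (|k|²/4)|m| ≥ 0 ≥ κρa·m − C₁ s N`. [folklore] -/
theorem coreIneq_iff_noSign {w : ℝ → ℝ≥0∞} {a M ρ₀ κ C₁ : ℝ} {N₀ : ℕ}
    (ha : 0 ≤ a) (hκ : 0 ≤ κ) (hC₁ : 0 ≤ C₁) :
    CoreIneq w a M ρ₀ κ C₁ N₀ ↔ CoreIneqNoSign w a M ρ₀ κ C₁ N₀ := by
  constructor
  · intro h N hN L hL hNL n hn hwin s hs hsa Φ hE hstat hsub
    rcases le_or_gt 0 (sourceMean n Φ) with hm | hm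
    · exact h N hN L hL hNL n hn hwin s hs hsa Φ hE hstat hsub hm
    · have hNf : 0 ≤ effNumber n Φ := effNumber_nonneg n Φ
      have hq0 : 0 ≤ ksq L n := ksq_nonneg L n
      have hNnn : (0 : ℝ) ≤ N := Nat.cast_nonneg N
      have hρa : 0 ≤ κ * (N / L ^ 3 * a) := by positivity
      have h1 : κ * (N / L ^ 3 * a) * sourceMean n Φ ≤ 0 := mul_nonpos_of_nonneg_of_nonpos hρa hm.le
      have h2 : ksq L n / 4 * sourceMean n Φ ≤ 0 :=
        mul_nonpos_of_nonneg_of_nonpos (div_nonneg hq0 (by norm_num)) hm.le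
      have h3 : 0 ≤ C₁ * s * N := by positivity
      have h4 : 0 ≤ s * effNumber n Φ := mul_nonneg hs hNf
      rw [kin_add_virial_eq_of_stationary hstat]
      linarith
  · intro h N hN L hL hNL n hn hwin s hs hsa Φ hE hstat hsub _hm
    exact h N hN L hL hNL n hn hwin s hs hsa Φ hE hstat hsub

/-- S2 with the sign binder deleted. -/
def ConstitutiveCoreNoSign : Prop :=
  ∀ v : ℝ → ℝ≥0∞, IsRepulsiveFiniteRange v → ∀ M : ℝ, 0 < M →
    ∃ ρ₀ κ C₁ : ℝ, 0 < ρ₀ ∧ 0 < κ ∧ 0 < C₁ ∧ ∃ N₀ t₀ : ℕ, ∀ t : ℕ, t₀ ≤ t →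
      CoreIneqNoSign (truncPotential v t) (scatteringLength v).toReal M ρ₀ κ C₁ N₀

/-- **S2 ⟺ S2 without the sign binder.** [folklore] -/
theorem constitutiveCore_iff_noSign : ConstitutiveCore ↔ ConstitutiveCoreNoSign := by
  constructor
  · intro h v hv M hM
    obtain ⟨ρ₀, κ, C₁, hρ₀, hκ, hC₁, N₀, t₀, hcore⟩ := h v hv M hM
    exact ⟨ρ₀, κ, C₁, hρ₀, hκ, hC₁, N₀, t₀, fun t ht =>
      (coreIneq_iff_noSign ENNReal.toReal_nonneg hκ.le hC₁.le).mp (hcore t ht)⟩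
  · intro h v hv M hM
    obtain ⟨ρ₀, κ, C₁, hρ₀, hκ, hC₁, N₀, t₀, hcore⟩ := h v hv M hM
    exact ⟨ρ₀, κ, C₁, hρ₀, hκ, hC₁, N₀, t₀, fun t ht =>
      (coreIneq_iff_noSign ENNReal.toReal_nonneg hκ.le hC₁.le).mpr (hcore t ht)⟩

/-- The LINEAR-RESPONSE form of the constitutive inequality: same binders as `CoreIneq`, conclusion
`(κρa + |k|²/4)·m ≤ s·N_eff + C₁·s·N`. -/
def CoreIneqLR (w : ℝ → ℝ≥0∞) (a M ρ₀ κ C₁ : ℝ) (N₀ : ℕ) : Prop :=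
  ∀ N : ℕ, N₀ ≤ N → ∀ L : ℝ, 0 < L → (N : ℝ) ≤ ρ₀ * L ^ 3 → ∀ n : Fin 3 → ℤ, n ≠ 0 →
    2 * Real.pi * ‖(fun j => (n j : ℝ))‖ / L ≤ M * Real.sqrt (N / L ^ 3) →
    ∀ s : ℝ, 0 ≤ s → s ≤ N / L ^ 3 * a →
    ∀ Φ : PeriodicTrialState N L, periodicEnergy w Φ ≠ ⊤ →
      stressWave w n Φ = s * effNumber n Φ →
      (periodicEnergy w Φ).toReal - s * sourceMean n Φ ≤ (periodicGroundStateEnergy w N L).toReal →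
      0 ≤ sourceMean n Φ →
        (κ * (N / L ^ 3 * a) + ksq L n / 4) * sourceMean n Φ ≤ s * effNumber n Φ + C₁ * s * N

/-- **On transport-stationary states the constitutive inequality IS the linear-response bound**
`m ≤ s(N_eff + C₁N)/(κρa + |k|²/4)` — a rearrangement of `K + (|k|²/4)m + I = s N_eff`. [folklore] -/
theorem coreIneq_iff_lr {w : ℝ → ℝ≥0∞} {a M ρ₀ κ C₁ : ℝ} {N₀ : ℕ} :
    CoreIneq w a M ρ₀ κ C₁ N₀ ↔ CoreIneqLR w a M ρ₀ κ C₁ N₀ := by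
  constructor
  · intro h N hN L hL hNL n hn hwin s hs hsa Φ hE hstat hsub hm
    have key := h N hN L hL hNL n hn hwin s hs hsa Φ hE hstat hsub hm
    have e := kin_add_virial_eq_of_stationary hstat
    have r : (κ * (N / L ^ 3 * a) + ksq L n / 4) * sourceMean n Φ =
        κ * (N / L ^ 3 * a) * sourceMean n Φ + ksq L n / 4 * sourceMean n Φ := by ring
    linarith
  · intro h N hN L hL hNL n hn hwin s hs hsa Φ hE hstat hsub hm
    have key := h N hN L hL hNL n hn hwin s hs hsa Φ hE hstat hsub hm
    have e := kin_add_virial_eq_of_stationary hstat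
    have r : (κ * (N / L ^ 3 * a) + ksq L n / 4) * sourceMean n Φ =
        κ * (N / L ^ 3 * a) * sourceMean n Φ + ksq L n / 4 * sourceMean n Φ := by ring
    linarith

/-- **Necessary size of `C₁`**: on a transport-stationary state the constitutive inequality forces
`(κρa + |k|²/4)·m ≤ (2 + C₁)·s·N` (as `N_eff ≤ 2N` is not needed here we record the sharper
`≤ s·N_eff + C₁ s N`); conversely it is implied by `(κρa + |k|²/4)·m ≤ C₁·s·N`.  The content of S2
is therefore exactly a bound `m(Φ) ≤ C s N/(ρa + |k|²)` on sub-ground transport-stationary states,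
i.e. the crux's chord at drive `2s`. [folklore] -/
theorem coreIneq_of_lr_bound {w : ℝ → ℝ≥0∞} {a M ρ₀ κ C₁ : ℝ} {N₀ : ℕ}
    (h : ∀ N : ℕ, N₀ ≤ N → ∀ L : ℝ, 0 < L → (N : ℝ) ≤ ρ₀ * L ^ 3 → ∀ n : Fin 3 → ℤ, n ≠ 0 →
      2 * Real.pi * ‖(fun j => (n j : ℝ))‖ / L ≤ M * Real.sqrt (N / L ^ 3) →
      ∀ s : ℝ, 0 ≤ s → s ≤ N / L ^ 3 * a →
      ∀ Φ : PeriodicTrialState N L, periodicEnergy w Φ ≠ ⊤ →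
        stressWave w n Φ = s * effNumber n Φ →
        (periodicEnergy w Φ).toReal - s * sourceMean n Φ ≤ (periodicGroundStateEnergy w N L).toReal →
        0 ≤ sourceMean n Φ →
          (κ * (N / L ^ 3 * a) + ksq L n / 4) * sourceMean n Φ ≤ C₁ * s * N) :
    CoreIneq w a M ρ₀ κ C₁ N₀ := by
  refine coreIneq_iff_lr.mpr fun N hN L hL hNL n hn hwin s hs hsa Φ hE hstat hsub hm => ?_
  have key := h N hN L hL hNL n hn hwin s hs hsa Φ hE hstat hsub hm
  have h4 : 0 ≤ s * effNumber n Φ := mul_nonneg hs (effNumber_nonneg n Φ)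
  linarith

/-! ## §4 S1: the mode binder `n ≠ 0` is load-bearing -/

/-- S1. Verbatim copy of the skeleton's `TransportStationary`. [card force-balance-constitutive] -/
def TransportStationary : Prop :=
  ∀ (N : ℕ) (L : ℝ) (w : ℝ → ℝ≥0∞), IsRepulsiveFiniteRange w → (∃ B : ℝ, ∀ r, w r ≤ ENNReal.ofReal B) →
    0 < L → ∀ n : Fin 3 → ℤ, n ≠ 0 → ∀ s : ℝ, 0 ≤ s → ∀ Φ : PeriodicTrialState N L,
      periodicEnergy w Φ ≠ ⊤ →
      ∃ Φ' : PeriodicTrialState N L, periodicEnergy w Φ' ≠ ⊤ ∧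
        (periodicEnergy w Φ').toReal - s * sourceMean n Φ' ≤
            (periodicEnergy w Φ).toReal - s * |sourceMean n Φ| ∧
        stressWave w n Φ' = s * effNumber n Φ'

/-- S1 with the binder `n ≠ 0` deleted (everything else verbatim). -/
def TransportStationaryAnyMode : Prop :=
  ∀ (N : ℕ) (L : ℝ) (w : ℝ → ℝ≥0∞), IsRepulsiveFiniteRange w → (∃ B : ℝ, ∀ r, w r ≤ ENNReal.ofReal B) →
    0 < L → ∀ n : Fin 3 → ℤ, ∀ s : ℝ, 0 ≤ s → ∀ Φ : PeriodicTrialState N L,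
      periodicEnergy w Φ ≠ ⊤ →
      ∃ Φ' : PeriodicTrialState N L, periodicEnergy w Φ' ≠ ⊤ ∧
        (periodicEnergy w Φ').toReal - s * sourceMean n Φ' ≤
            (periodicEnergy w Φ).toReal - s * |sourceMean n Φ| ∧
        stressWave w n Φ' = s * effNumber n Φ'

/-- S1 is the `n ≠ 0` restriction of the mutated statement. [folklore] -/
theorem transportStationary_of_anyMode (h : TransportStationaryAnyMode) : TransportStationary :=
  fun N L w hw hb hL n _ s hs Φ hΦ => h N L w hw hb hL n s hs Φ hΦ

section ZeroMode

variable {N : ℕ} {L : ℝ}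

/-- At `n = 0`: `|k|² = 0`. [folklore] -/
theorem ksq_zero_mode (L : ℝ) : ksq L 0 = 0 := by
  simp [ksq]

/-- At `n = 0` every phase vanishes. [folklore] -/
theorem phase_zero_mode (L : ℝ) (X : Config N) (i : Fin N) : phase L 0 X i = 0 := by
  simp [phase]

/-- At `n = 0` the kinetic stress wave vanishes (its weight `1/|k|²` is Lean-junk `1/0 = 0`). [folklore] -/
theorem kineticStressWave_zero_mode (Φ : PeriodicTrialState N L) : kineticStressWave 0 Φ = 0 := by
  unfold kineticStressWave
  simp [ksq_zero_mode]

/-- At `n = 0`: `N_eff = 0`. [folklore] -/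
theorem effNumber_zero_mode (Φ : PeriodicTrialState N L) : effNumber 0 Φ = 0 := by
  unfold effNumber
  simp [phase_zero_mode]

/-- At `n = 0` the virial wave degenerates to `N ∫ W |Φ|²` (here written with the sum over particles). [folklore] -/
theorem virialWave_zero_mode (w : ℝ → ℝ≥0∞) (Φ : PeriodicTrialState N L) :
    virialWave w 0 Φ = ∫ X in cellN N L, (periodicInteraction w L X).toReal * (N * ‖Φ.ψ X‖ ^ 2) := by
  unfold virialWave
  congr 1
  funext X
  simp [phase_zero_mode]

/-- At `n = 0` the stress wave is the degenerate virial wave. [folklore] -/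
theorem stressWave_zero_mode (w : ℝ → ℝ≥0∞) (Φ : PeriodicTrialState N L) :
    stressWave w 0 Φ = ∫ X in cellN N L, (periodicInteraction w L X).toReal * (N * ‖Φ.ψ X‖ ^ 2) := by
  unfold stressWave
  rw [kineticStressWave_zero_mode, ksq_zero_mode, virialWave_zero_mode]
  ring

end ZeroMode

/-- `ω₃ = |B₁| > 0`. [folklore] -/
theorem ω₃_pos : 0 < ω₃ :=
  ENNReal.toReal_pos (Metric.measure_closedBall_pos volume _ one_pos).ne' measure_closedBall_lt_top.ne

/-- `#pairs(2) = 1`. [folklore] -/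
theorem pairCount_two : pairCount 2 = 1 := by
  unfold pairCount
  decide

/-- The witness potential: the square well of height `1` and radius `2`. -/
abbrev wsq : ℝ → ℝ≥0∞ := sqWell 1 2

/-- The witness potential is bounded by `1`. [folklore] -/
theorem wsq_le_one (r : ℝ) : wsq r ≤ ENNReal.ofReal 1 := by
  unfold wsq sqWell
  by_cases hr : r ∈ Set.Iic (2 : ℝ)
  · rw [Set.indicator_of_mem hr]
  · rw [Set.indicator_of_notMem hr]; exact bot_le

/-- On the torus of side `1`, `ω₃ ≤ w^per ≤ 27 ω₃` everywhere. [folklore] -/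
theorem wsq_periodized_bounds (y : Space) :
    ENNReal.ofReal ω₃ ≤ periodizedPotential wsq 1 y ∧
      periodizedPotential wsq 1 y ≤ ENNReal.ofReal (27 * ω₃) := by
  constructor
  · have h := le_periodizedPotential_sqWell (K := 1) (R := 2) (L := 1) zero_le_one one_pos
      (by norm_num) y
    refine le_trans (le_of_eq ?_) h
    congr 1; norm_num
  · have h := periodizedPotential_sqWell_le (K := 1) (R := 2) (L := 1) zero_le_one (by norm_num)
      one_pos y
    refine h.trans (le_of_eq ?_)
    congr 1; norm_num

/-- Two particles: `ω₃ ≤ W ≤ 27 ω₃` on every configuration. [folklore] -/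
theorem wsq_interaction_bounds (X : Config 2) :
    ENNReal.ofReal ω₃ ≤ periodicInteraction wsq 1 X ∧
      periodicInteraction wsq 1 X ≤ ENNReal.ofReal (27 * ω₃) := by
  constructor
  · have h := le_periodicInteraction_of_le (N := 2) (fun y => (wsq_periodized_bounds y).1) X
    rwa [pairCount_two, Nat.cast_one, one_mul] at h
  · have h := periodicInteraction_le_of_le (N := 2) (fun y => (wsq_periodized_bounds y).2) X
    rwa [pairCount_two, Nat.cast_one, one_mul] at h

/-- **`n ≠ 0` is load-bearing in S1.** [folklore] -/
theorem not_transportStationaryAnyMode : ¬ TransportStationaryAnyMode := by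
  intro h
  have hL : (0 : ℝ) < 1 := one_pos
  -- the data
  have hw : IsRepulsiveFiniteRange wsq := isRepulsiveFiniteRange_sqWell 1 2
  have hb : ∃ B : ℝ, ∀ r, wsq r ≤ ENNReal.ofReal B := ⟨1, wsq_le_one⟩
  -- the modulated product state has finite energy
  set Φ : PeriodicTrialState 2 1 := prodState 2 hL with hΦdef
  have hΦE : periodicEnergy wsq Φ ≠ ⊤ := by
    have hle := periodicEnergy_le_of_pointwise Φ (v := wsq)
      (t := ENNReal.ofReal (3 * (2 : ℕ) * (2 * Real.pi / 1) ^ 2)) (b := ENNReal.ofReal (27 * ω₃))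
      ENNReal.ofReal_ne_top ENNReal.ofReal_ne_top
      (fun X => by rw [hΦdef]; exact kineticDensity_prodState_le 2 hL X)
      (fun y => (wsq_periodized_bounds y).2)
    exact ne_top_of_le_ne_top (by
      refine ENNReal.add_ne_top.mpr ⟨ENNReal.ofReal_ne_top, ENNReal.mul_ne_top (by simp) ENNReal.ofReal_ne_top⟩)
      hle
  obtain ⟨Φ', -, -, hstat⟩ := h 2 1 wsq hw hb hL 0 0 le_rfl Φ hΦE
  -- at `n = 0`, `s = 0` stationarity says `∫ W · 2|Φ'|² = 0`
  rw [stressWave_zero_mode, zero_mul] at hstat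
  -- but the integrand is `≥ 2 ω₃ |Φ'|²`
  have hψc : Continuous fun X : Config 2 => ‖Φ'.ψ X‖ ^ 2 := (Φ'.contDiff.continuous.norm).pow 2
  have hWm : Measurable fun X : Config 2 => (periodicInteraction wsq 1 X).toReal :=
    (measurable_periodicInteraction hw.1 1).ennreal_toReal
  have hlow : ∀ X : Config 2, ω₃ ≤ (periodicInteraction wsq 1 X).toReal := fun X =>
    (ENNReal.ofReal_le_iff_le_toReal
      (ne_top_of_le_ne_top ENNReal.ofReal_ne_top (wsq_interaction_bounds X).2)).mp
      (wsq_interaction_bounds X).1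
  have hup : ∀ X : Config 2, (periodicInteraction wsq 1 X).toReal ≤ 27 * ω₃ := fun X =>
    ENNReal.toReal_le_of_le_ofReal (by positivity [ω₃_nonneg]) (wsq_interaction_bounds X).2
  have hgi : Integrable (fun X : Config 2 => ω₃ * ((2 : ℕ) * ‖Φ'.ψ X‖ ^ 2))
      (volume.restrict (cellN 2 1)) :=
    integrableOn_cellN (continuous_const.mul (continuous_const.mul hψc)) 1
  have hGi : Integrable (fun X : Config 2 => 27 * ω₃ * ((2 : ℕ) * ‖Φ'.ψ X‖ ^ 2))
      (volume.restrict (cellN 2 1)) :=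
    integrableOn_cellN (continuous_const.mul (continuous_const.mul hψc)) 1
  have hfi : Integrable (fun X : Config 2 =>
      (periodicInteraction wsq 1 X).toReal * ((2 : ℕ) * ‖Φ'.ψ X‖ ^ 2)) (volume.restrict (cellN 2 1)) := by
    refine hGi.mono' (hWm.aestronglyMeasurable.mul
      (continuous_const.mul hψc).aestronglyMeasurable) (Filter.Eventually.of_forall fun X => ?_)
    rw [Real.norm_eq_abs, abs_of_nonneg (mul_nonneg ENNReal.toReal_nonneg (by positivity))]
    exact mul_le_mul_of_nonneg_right (hup X) (by positivity)
  have hmono : ∫ X in cellN 2 1, ω₃ * ((2 : ℕ) * ‖Φ'.ψ X‖ ^ 2) ≤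
      ∫ X in cellN 2 1, (periodicInteraction wsq 1 X).toReal * ((2 : ℕ) * ‖Φ'.ψ X‖ ^ 2) :=
    integral_mono hgi hfi fun X => mul_le_mul_of_nonneg_right (hlow X) (by positivity)
  have hval : ∫ X in cellN 2 1, ω₃ * ((2 : ℕ) * ‖Φ'.ψ X‖ ^ 2) = 2 * ω₃ := by
    rw [integral_const_mul, integral_const_mul, integral_norm_sq_eq_one]
    push_cast
    ring
  rw [hstat] at hmono
  rw [hval] at hmono
  linarith [ω₃_pos]

end

end Summit.AtomisticToContinuum.BoseEinsteinCondensation.Theorems.DensityResponse.Negative.ForceBalanceStubs
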